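import Mathlib

/-!
# PercRepro — THE ARITHMETIC OF THE COLOOP-SHARE KERNEL (p4, gen 37; paper proofs/P4-CRUX-K2.md, Lemmas 4–5)

Two facts about binomial coefficients used by the proof of the UP-Hall form of C-044 at the tight layer, `k = 2`:
* the **hockey-stick bound** `(1 + u) · C(q + j − u, j) ≤ C(q + j + 1, j + 1)` for `u ≤ q`
  (`one_add_mul_choose_le`), which bounds the product «number of used coloops × number of member-bases» of a set
  `R + o` uniformly in the matroid;
* the **identity** behind the receipts: with `P_j = ∏_{i<j} (d − i)/(q + 2 + i)` one has
  `(q+1)·C(d,j) = (j+1)·C(q+j+1, j+1)·P_j` (`choose_eq_P`) and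
  `(q + 2 − d) · Σ_{j ≤ d} (j+1) P_j = (q + 1) + Σ_j P_j + (q − d) Σ_j j P_j ≥ q + 2` (`key_identity`, `key_ge`),
  whence `(q+2)/(q+1) ≤ (q + 2 − d) · Σ_{j ≤ d} C(d,j)/C(q+j+1, j+1)` for `d ≤ q` (`receipt_bound`).
Axioms: standard.
-/

namespace PercRepro.CoopShare

open Finset

/-- **Hockey stick bound**: `(1 + u) · C(q + j − u, j) ≤ C(q + j + 1, j + 1)` for `u ≤ q`. -/
theorem one_add_mul_choose_le (q j u : ℕ) (hu : u ≤ q) :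
    (1 + u) * (q + j - u).choose j ≤ (q + j + 1).choose (j + 1) := by
  -- (1+u)·C(q+j−u, j) = Σ_{i ∈ range (u+1)} C(q+j−u, j) ≤ Σ_{i ∈ range (u+1)} C(q+j−i, j)
  have h1 : (1 + u) * (q + j - u).choose j = ∑ i ∈ range (u + 1), (q + j - u).choose j := by
    rw [Finset.sum_const, Finset.card_range, smul_eq_mul, add_comm]
  have h2 : ∑ i ∈ range (u + 1), (q + j - u).choose j ≤ ∑ i ∈ range (u + 1), (q + j - i).choose j := by
    apply Finset.sum_le_sum
    intro i hi
    rw [Finset.mem_range] at hi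
    exact Nat.choose_le_choose j (by omega)
  have h3 : ∑ i ∈ range (u + 1), (q + j - i).choose j ≤ ∑ i ∈ range (q + 1), (q + j - i).choose j := by
    apply Finset.sum_le_sum_of_subset_of_nonneg
    · intro i hi
      rw [Finset.mem_range] at hi ⊢
      omega
    · intro i _ _
      exact Nat.zero_le _
  -- Σ_{i ∈ range (q+1)} C(q+j−i, j) = Σ_{m ∈ Icc j (q+j)} C(m, j) = C(q+j+1, j+1)
  have h4 : ∑ i ∈ range (q + 1), (q + j - i).choose j = ∑ m ∈ Icc j (q + j), m.choose j := by
    -- reflect the range: i ↦ q + j − i is a bijection range (q+1) → Icc j (q+j)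
    apply Finset.sum_nbij' (fun i => q + j - i) (fun m => q + j - m)
    · intro i hi
      rw [Finset.mem_range] at hi
      rw [Finset.mem_Icc]
      omega
    · intro m hm
      rw [Finset.mem_Icc] at hm
      rw [Finset.mem_range]
      omega
    · intro i hi
      rw [Finset.mem_range] at hi
      omega
    · intro m hm
      rw [Finset.mem_Icc] at hm
      omega
    · intro i _
      rfl
  rw [h1]
  calc ∑ i ∈ range (u + 1), (q + j - u).choose j ≤ ∑ i ∈ range (u + 1), (q + j - i).choose j := h2
    _ ≤ ∑ i ∈ range (q + 1), (q + j - i).choose j := h3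
    _ = ∑ m ∈ Icc j (q + j), m.choose j := h4
    _ = (q + j + 1).choose (j + 1) := Nat.sum_Icc_choose _ _

/-- `P_j = ∏_{i < j} (d − i)/(q + 2 + i)` (rational). -/
noncomputable def P (q d j : ℕ) : ℚ := ∏ i ∈ range j, (((d : ℚ) - i) / ((q : ℚ) + 2 + i))

/-- `P_0 = 1`. -/
theorem P_zero (q d : ℕ) : P q d 0 = 1 := by
  unfold P
  simp

/-- The recurrence `P_{j+1} = P_j · (d − j)/(q + 2 + j)`. -/
theorem P_succ (q d j : ℕ) : P q d (j + 1) = P q d j * (((d : ℚ) - j) / ((q : ℚ) + 2 + j)) := by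
  unfold P
  rw [Finset.prod_range_succ]

/-- `P_j ≥ 0` for `j ≤ d` (every factor is non-negative). -/
theorem P_nonneg (q d : ℕ) {j : ℕ} (hjd : j ≤ d) : 0 ≤ P q d j := by
  unfold P
  apply Finset.prod_nonneg
  intro i hi
  rw [Finset.mem_range] at hi
  apply div_nonneg
  · have : (i : ℚ) ≤ d := by exact_mod_cast (by omega : i ≤ d)
    linarith
  · positivity

/-- `P_j = 0` for `j > d` (the factor `i = d` vanishes). -/
theorem P_eq_zero_of_lt (q d : ℕ) {j : ℕ} (hdj : d < j) : P q d j = 0 := by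
  unfold P
  apply Finset.prod_eq_zero (i := d)
  · rw [Finset.mem_range]; exact hdj
  · simp

/-- `(q+1)·C(d,j) = (j+1)·C(q+j+1, j+1)·P_j` for every `j` (both sides vanish for `j > d`). -/
theorem choose_eq_P (q d : ℕ) : ∀ j : ℕ,
    ((q : ℚ) + 1) * (d.choose j : ℚ) = ((j : ℚ) + 1) * ((q + j + 1).choose (j + 1) : ℚ) * P q d j := by
  intro j
  induction j with
  | zero =>
    rw [P_zero]
    simp
  | succ j ih =>
    -- multiply the target by (j + 1) ≠ 0
    have hj : ((j : ℚ) + 1) ≠ 0 := by positivity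
    apply mul_right_cancel₀ hj
    -- left: (q+1)·C(d,j+1)·(j+1) = (q+1)·C(d,j)·(d − j)   (Nat.choose_succ_right_eq)
    have hL : ((q : ℚ) + 1) * (d.choose (j + 1) : ℚ) * ((j : ℚ) + 1)
        = ((q : ℚ) + 1) * (d.choose j : ℚ) * ((d : ℚ) - j) := by
      by_cases hjd : j < d
      · have h := Nat.choose_succ_right_eq d j
        have h' : ((d.choose (j + 1) : ℕ) : ℚ) * ((j : ℚ) + 1) = (d.choose j : ℚ) * ((d : ℚ) - j) := by
          have hsub : ((d - j : ℕ) : ℚ) = (d : ℚ) - j := by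
            rw [Nat.cast_sub (le_of_lt hjd)]
          rw [← hsub]
          exact_mod_cast h
        rw [mul_assoc, h', mul_assoc]
      · have hjd' : d ≤ j := not_lt.mp hjd
        have h0 : d.choose (j + 1) = 0 := Nat.choose_eq_zero_of_lt (by omega)
        have h1 : (d.choose j : ℚ) * ((d : ℚ) - j) = 0 := by
          by_cases hdj : d = j
          · subst hdj; simp
          · have : d < j := lt_of_le_of_ne hjd' hdj
            rw [Nat.choose_eq_zero_of_lt this]; simp
        rw [h0]
        push_cast
        rw [mul_assoc ((q : ℚ) + 1) (d.choose j : ℚ), h1]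
        ring
    -- right: (j+2)·C(q+j+2, j+2)·P_{j+1}·(j+1) = C(q+j+1, j+1)·(j+1)·P_j·(d − j)
    have hR : (((j + 1 : ℕ) : ℚ) + 1) * ((q + j + 1 + 1).choose (j + 1 + 1) : ℚ) * P q d (j + 1) * ((j : ℚ) + 1)
        = ((q : ℚ) + 1) * (d.choose j : ℚ) * ((d : ℚ) - j) := by
      rw [P_succ]
      -- (q+j+2)·C(q+j+1, j+1) = C(q+j+2, j+2)·(j+2)
      have h := Nat.add_one_mul_choose_eq (q + j + 1) (j + 1)
      have h' : ((q : ℚ) + j + 2) * ((q + j + 1).choose (j + 1) : ℚ)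
          = ((q + j + 1 + 1).choose (j + 1 + 1) : ℚ) * ((j : ℚ) + 2) := by
        have := congrArg (fun n : ℕ => (n : ℚ)) h
        push_cast at this
        linear_combination this
      have hq : ((q : ℚ) + 2 + j) ≠ 0 := by positivity
      have hinv : ((q : ℚ) + 2 + j)⁻¹ * ((q : ℚ) + 2 + j) = 1 := inv_mul_cancel₀ hq
      rw [ih, div_eq_mul_inv]
      push_cast
      linear_combination (-(((j : ℚ) + 1) * (P q d j) * ((d : ℚ) - j) * ((q : ℚ) + 2 + j)⁻¹)) * h'
        + (((j : ℚ) + 1) * ((q + j + 1).choose (j + 1) : ℚ) * (P q d j) * ((d : ℚ) - j)) * hinv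
    rw [show q + (j + 1) + 1 = q + j + 1 + 1 by omega, hL, ← hR]

/-- The telescoped recurrence: `(q + 1 − d) · Σ_{j ≤ d} P_j + 2 · Σ_{j ≤ d} j P_j = q + 1`. -/
theorem key_identity (q d : ℕ) :
    ((q : ℚ) + 1 - d) * (∑ j ∈ range (d + 1), P q d j) + 2 * (∑ j ∈ range (d + 1), (j : ℚ) * P q d j)
      = (q : ℚ) + 1 := by
  -- termwise: (q + 2 + j) P_{j+1} = (d − j) P_j
  have hterm : ∀ j : ℕ, ((q : ℚ) + 2 + j) * P q d (j + 1) = ((d : ℚ) - j) * P q d j := by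
    intro j
    rw [P_succ]
    have hq : ((q : ℚ) + 2 + j) ≠ 0 := by positivity
    field_simp
  have hsum : ∑ j ∈ range (d + 1), ((q : ℚ) + 2 + j) * P q d (j + 1)
      = ∑ j ∈ range (d + 1), ((d : ℚ) - j) * P q d j := Finset.sum_congr rfl (fun j _ => hterm j)
  -- shift the left sum: Σ_{j<d+1} (q+2+j) P_{j+1} = Σ_{j<d+2} (q+1+j) P_j − (q+1) P_0
  have hshift : ∑ j ∈ range (d + 1), ((q : ℚ) + 2 + j) * P q d (j + 1)
      = ∑ j ∈ range (d + 1), ((q : ℚ) + 1 + j) * P q d j - ((q : ℚ) + 1) := by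
    have h1 : ∑ j ∈ range (d + 1 + 1), ((q : ℚ) + 1 + j) * P q d j
        = ∑ j ∈ range (d + 1), ((q : ℚ) + 1 + ((j + 1 : ℕ) : ℚ)) * P q d (j + 1) + ((q : ℚ) + 1 + ((0 : ℕ) : ℚ)) * P q d 0 :=
      Finset.sum_range_succ' (fun j => ((q : ℚ) + 1 + j) * P q d j) (d + 1)
    have h2 : ∑ j ∈ range (d + 1 + 1), ((q : ℚ) + 1 + j) * P q d j
        = ∑ j ∈ range (d + 1), ((q : ℚ) + 1 + j) * P q d j + ((q : ℚ) + 1 + ((d + 1 : ℕ) : ℚ)) * P q d (d + 1) :=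
      Finset.sum_range_succ (fun j => ((q : ℚ) + 1 + j) * P q d j) (d + 1)
    rw [P_eq_zero_of_lt q d (by omega : d < d + 1), mul_zero, add_zero] at h2
    rw [P_zero] at h1
    have h3 : ∑ j ∈ range (d + 1), ((q : ℚ) + 1 + ((j + 1 : ℕ) : ℚ)) * P q d (j + 1)
        = ∑ j ∈ range (d + 1), ((q : ℚ) + 2 + j) * P q d (j + 1) := by
      apply Finset.sum_congr rfl
      intro j _
      push_cast
      ring
    rw [h3] at h1
    push_cast at h1
    linarith
  rw [hshift] at hsum
  -- Σ (q+1+j) P_j − (q+1) = Σ (d − j) P_j  ⟹  Σ (q+1−d+2j) P_j = q+1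
  have h4 : ∑ j ∈ range (d + 1), ((q : ℚ) + 1 + j) * P q d j - ∑ j ∈ range (d + 1), ((d : ℚ) - j) * P q d j
      = ((q : ℚ) + 1 - d) * (∑ j ∈ range (d + 1), P q d j) + 2 * (∑ j ∈ range (d + 1), (j : ℚ) * P q d j) := by
    rw [← Finset.sum_sub_distrib, Finset.mul_sum, Finset.mul_sum, ← Finset.sum_add_distrib]
    apply Finset.sum_congr rfl
    intro j _
    ring
  linarith

/-- **The receipt identity**: `(q + 2 − d) · Σ_{j ≤ d} (j + 1) P_j = (q + 1) + Σ_j P_j + (q − d) · Σ_j j P_j`. -/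
theorem key_eq (q d : ℕ) :
    ((q : ℚ) + 2 - d) * (∑ j ∈ range (d + 1), ((j : ℚ) + 1) * P q d j)
      = (q : ℚ) + 1 + (∑ j ∈ range (d + 1), P q d j) + ((q : ℚ) - d) * (∑ j ∈ range (d + 1), (j : ℚ) * P q d j) := by
  have hk := key_identity q d
  have hsplit : ∑ j ∈ range (d + 1), ((j : ℚ) + 1) * P q d j
      = (∑ j ∈ range (d + 1), (j : ℚ) * P q d j) + ∑ j ∈ range (d + 1), P q d j := by
    rw [← Finset.sum_add_distrib]
    apply Finset.sum_congr rfl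
    intro j _
    ring
  rw [hsplit]
  linear_combination hk

/-- **The receipt bound**: for `d ≤ q`, `(q + 2 − d) · Σ_{j ≤ d} (j + 1) P_j ≥ q + 2`. -/
theorem key_ge (q d : ℕ) (hd : d ≤ q) :
    (q : ℚ) + 2 ≤ ((q : ℚ) + 2 - d) * (∑ j ∈ range (d + 1), ((j : ℚ) + 1) * P q d j) := by
  rw [key_eq]
  have hS : 1 ≤ ∑ j ∈ range (d + 1), P q d j := by
    have h0 : P q d 0 ≤ ∑ j ∈ range (d + 1), P q d j := by
      apply Finset.single_le_sum (f := fun j => P q d j)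
      · intro j hj
        rw [Finset.mem_range] at hj
        exact P_nonneg q d (by omega)
      · rw [Finset.mem_range]; omega
    rw [P_zero] at h0
    exact h0
  have hT : 0 ≤ ∑ j ∈ range (d + 1), (j : ℚ) * P q d j := by
    apply Finset.sum_nonneg
    intro j hj
    rw [Finset.mem_range] at hj
    exact mul_nonneg (by positivity) (P_nonneg q d (by omega))
  have hqd : (0 : ℚ) ≤ (q : ℚ) - d := by
    have : (d : ℚ) ≤ q := by exact_mod_cast hd
    linarith
  nlinarith [mul_nonneg hqd hT]

/-- **The receipt bound in binomial form**: for `d ≤ q`,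
`(q + 2)/(q + 1) ≤ (q + 2 − d) · Σ_{j ≤ d} C(d, j) / C(q + j + 1, j + 1)`. -/
theorem receipt_bound (q d : ℕ) (hd : d ≤ q) :
    ((q : ℚ) + 2) / ((q : ℚ) + 1)
      ≤ ((q : ℚ) + 2 - d) * ∑ j ∈ range (d + 1), (d.choose j : ℚ) / ((q + j + 1).choose (j + 1) : ℚ) := by
  have hq : ((q : ℚ) + 1) ≠ 0 := by positivity
  have hconv : ∀ j ∈ range (d + 1), (d.choose j : ℚ) / ((q + j + 1).choose (j + 1) : ℚ)
      = (((j : ℚ) + 1) * P q d j) / ((q : ℚ) + 1) := by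
    intro j _
    have hc : ((q + j + 1).choose (j + 1) : ℚ) ≠ 0 := by
      have : 0 < (q + j + 1).choose (j + 1) := Nat.choose_pos (by omega)
      exact_mod_cast this.ne'
    have h := choose_eq_P q d j
    field_simp
    linear_combination h
  rw [Finset.sum_congr rfl hconv, ← Finset.sum_div]
  have hk := key_ge q d hd
  rw [div_le_iff₀ (by positivity : (0 : ℚ) < (q : ℚ) + 1)]
  calc (q : ℚ) + 2 ≤ ((q : ℚ) + 2 - d) * (∑ j ∈ range (d + 1), ((j : ℚ) + 1) * P q d j) := hk
    _ = ((q : ℚ) + 2 - d) * ((∑ j ∈ range (d + 1), ((j : ℚ) + 1) * P q d j) / ((q : ℚ) + 1)) * ((q : ℚ) + 1) := by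
        field_simp

end PercRepro.CoopShare
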